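import Literature.NumberTheory.EllipticCurves.ThreeIsogenySelmerRatioTwistFamilies
import HarnessLib

/-!
# The Markov–parity step of Bhargava–Klagsbrun–Lemke Oliver–Shnidman 2019, §9.2, over square-class
# averages: "average `3`-Selmer rank `≤ 1` and all ranks even ⟹ at least `50%` have rank `0`"

`Proofs` file (theorems only; no definition, no named fact — D-0014/D-0026), cross-ladder
literature-typing layer (cell `bsd-littype`, seat 08, gen 5). Companion of
`ThreeIsogenySelmerRatioTwistFamilies.lean` (BKLOS Duke 168 (2019) §2: `squareClassProportion`,
`HasSquareClassDensity`, `squareClassAverage`, `SquareClassAverageLe`, Thms. 2.4–2.7 as named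
facts).

Bhargava–Klagsbrun–Lemke Oliver–Shnidman, *`3`-isogeny Selmer groups and ranks of abelian varieties
in quadratic twist families over a number field*, Duke Math. J. 168 (2019), §9.2 "Proof of Theorem
2.5" (held text `paper:arxiv-1709.09790`, chunk p0014 L43–L47), VERBATIM: "Let `T_m(φ)` be as in the
previous proof, so that the average of the rank of `Sel_3(E_s)` for `s ∈ T_0(φ)` is at most `1`. The
only additional input needed is a result of Cassels which shows that if `s ∈ T_m(φ)`, then
`dim_{𝔽₃} Sel_3(E_s) ≡ m (mod 2)`; see [BES]. In particular, every twist within `T_0(φ)` has even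
`3`-Selmer rank, so it follows that at least `50%` of the twists in `T_0(φ)` have rank `0`.
Similarly, for twists in either `T_1(φ)` or `T_{-1}(φ)`, the `3`-Selmer rank is odd and the average
`3`-Selmer rank is `4/3`. It then immediately follows that at least `5/6` of such twists must have
`3`-Selmer rank `1`."

The step "average `≤ B` + parity ⟹ proportion" is an elementary Markov-type inequality; this file
PROVES it in the kernel over the square-class vocabulary, for a subfamily `S ⊆ K^×/(K^×)²` with a
density `μ` (BKLOS: `S = T_m(φ)`, `μ = μ(T_m(φ))`) and any `ℕ`-valued class function `f` taking on
`S` only the value `m₀` or values `≥ m₀ + 2`: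

* `squareClassProportionGe_of_density_of_averageLe` — **at least `μ · (1 − (B − m₀)/2)` of all
  classes lie in `S` and have `f = m₀`**, if `S` has density `μ`, `f|_S ∈ {m₀} ∪ [m₀ + 2, ∞)` and the
  average of `f` over `s ∈ S` (ordered by height) is at most `B`. Specialisations: even values,
  `B = 1` ⟹ `≥ μ/2` with `f = 0` (`…_even_of_averageLe_one`, the factor `½` of Thm. 2.5 (a)); odd
  values, `B = 4/3` ⟹ `≥ ⅚ μ` with `f = 1` (`…_odd_of_averageLe_four_thirds`, the factor `⅚` of
  Thm. 2.5 (b)); `S =` everything (`…_univ_…`).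
* the finite count behind it, `mul_card_add_two_mul_le_finsum`
  (`m₀ #A + 2 (#A − #{f = m₀}) ≤ ∑_A f`), and `[0, 1]`-bounds for proportions and densities
  (`squareClassProportion_nonneg/_le_one`, `HasSquareClassDensity.nonneg/.le_one`,
  `squareClassProportionGe_of_nonpos`, `hasSquareClassDensity_true`).
* `BhargavaKlagsbrunLemkeOliverShnidman2019.proportion_rank_zero_half_of_thm27_of_even` — a
  read-out in a twist family: Thm. 2.7's "average rank `≤ 1`" together with "every twist has even
  rank" (the situation of the source's remark after Thm. 2.7: "they all have even parity") gives
  `≥ 50%` rank `0` by the Markov step alone (the source proves its `50%` through `3`-Selmer parity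
  instead; this is the kernel form of the minimalist bookkeeping, conditional on the parity input).

What is NOT here: the two printed inputs of §9.2 themselves — "the average of the rank of
`Sel_3(E_s)` for `s ∈ T_0(φ)` is at most `1`" (Thm. 2.1 + Cassels' formula + convexity, §9.1) and
Cassels' parity `dim Sel_3(E_s) ≡ m (mod 2)` on `T_m(φ)` — which need the `φ`-Selmer group of an
isogeny (not in the tree); with them as inputs, the theorem below yields Thm. 2.5 (a)/(b) verbatim.

## References

* [BhargavaKlagsbrunLemkeOliverShnidman2019] Duke Math. J. 168 (2019) 2951–2989 =
  arXiv:1709.09790, §9.2 (chunk p0014 L43–L47), Thm. 2.5 (chunk p0005 L16–L22), Thm. 2.7 and the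
  remark after it (chunk p0006 L1–L4).
-/

noncomputable section

open scoped Classical NumberField TensorProduct
open Filter Topology
open WeierstrassCurve

universe u

namespace Literature.NumberTheory.EllipticCurves

/-! ## §1 Proportions and densities lie in `[0, 1]` -/

section Basic

variable {K : Type u} [Field K] [NumberField K]

/-- Proportions are `≥ 0`. [cite: BhargavaKlagsbrunLemkeOliverShnidman2019, §2 (chunk p0004 L29–L31, Σ(X))] -/
theorem squareClassProportion_nonneg (P : SquareClass K → Prop) (X : ℕ) :
    0 ≤ squareClassProportion P X :=
  div_nonneg (Nat.cast_nonneg _) (Nat.cast_nonneg _)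

/-- Proportions are `≤ 1` (`{H < X ∧ P} ⊆ {H < X}`, a finite set).
[cite: BhargavaKlagsbrunLemkeOliverShnidman2019, §2 (chunk p0004 L29–L31, Σ(X))] -/
theorem squareClassProportion_le_one (P : SquareClass K → Prop) (X : ℕ) :
    squareClassProportion P X ≤ 1 := by
  refine div_le_one_of_le₀ ?_ (Nat.cast_nonneg _)
  exact_mod_cast Nat.card_mono (finite_setOf_squareClassHeight_lt X)
    fun t (ht : squareClassHeight t < X ∧ P t) ↦ ht.1

/-- A density is `≥ 0`. [cite: BhargavaKlagsbrunLemkeOliverShnidman2019, §2 (chunk p0005 L14, the density μ(T_m(φ)))] -/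
theorem HasSquareClassDensity.nonneg {P : SquareClass K → Prop} {μ : ℝ}
    (h : HasSquareClassDensity P μ) : 0 ≤ μ :=
  ge_of_tendsto' h fun X ↦ squareClassProportion_nonneg P X

/-- A density is `≤ 1`. [cite: BhargavaKlagsbrunLemkeOliverShnidman2019, §2 (chunk p0005 L14, the density μ(T_m(φ)))] -/
theorem HasSquareClassDensity.le_one {P : SquareClass K → Prop} {μ : ℝ}
    (h : HasSquareClassDensity P μ) : μ ≤ 1 :=
  le_of_tendsto' h fun X ↦ squareClassProportion_le_one P X

/-- Lower proportions `≤ 0` hold for every property (the proportion sequence is `≥ 0`).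
[cite: BhargavaKlagsbrunLemkeOliverShnidman2019, §2 (chunk p0004 L29–L31)] -/
theorem squareClassProportionGe_of_nonpos (P : SquareClass K → Prop) {δ : ℝ} (hδ : δ ≤ 0) :
    SquareClassProportionGe P δ := by
  rw [squareClassProportionGe_iff_liminf]
  refine hδ.trans (le_liminf_of_le
    (Filter.IsBoundedUnder.isCoboundedUnder_ge
      (isBoundedUnder_of ⟨1, fun X ↦ squareClassProportion_le_one P X⟩))
    (Eventually.of_forall fun X ↦ squareClassProportion_nonneg P X))

/-- The whole of `K^×/(K^×)²` has density `1` (`#Σ(X) ≥ 1` eventually, `#Σ(X) → ∞`).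
[cite: BhargavaKlagsbrunLemkeOliverShnidman2019, §2 (chunk p0005 L14, "density … within F*/F*²")] -/
theorem hasSquareClassDensity_true : HasSquareClassDensity (fun _ : SquareClass K ↦ True) 1 := by
  have hev : ∀ᶠ X : ℕ in atTop, squareClassProportion (fun _ : SquareClass K ↦ True) X = 1 := by
    filter_upwards [(tendsto_natCard_squareClassHeight_lt_atTop (K := K)).eventually_ge_atTop 1]
      with X hX
    have hset : {t : SquareClass K | squareClassHeight t < X ∧ True} =
        {t : SquareClass K | squareClassHeight t < X} := by
      ext t; simp
    unfold squareClassProportion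
    rw [hset]
    have hne : (Nat.card {t : SquareClass K | squareClassHeight t < X} : ℝ) ≠ 0 := by
      exact_mod_cast (Nat.one_le_iff_ne_zero.mp hX)
    exact div_self hne
  exact (tendsto_congr' hev).mpr tendsto_const_nhds

end Basic

/-! ## §2 The Markov–parity step (BKLOS §9.2) -/

section Markov

variable {K : Type u} [Field K] [NumberField K]

omit [NumberField K] in
/-- **Finite Markov–parity count.** On a finite set `A` of classes, if `f` takes only the value
`m₀` or values `≥ m₀ + 2`, then `m₀ · #A + 2 · (#A − #{t ∈ A : f t = m₀}) ≤ ∑_{t ∈ A} f t`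
(each class with `f ≠ m₀` contributes at least `m₀ + 2`).
[cite: BhargavaKlagsbrunLemkeOliverShnidman2019, §9.2 (chunk p0014 L45–L47, the counting behind "at least 50%" / "at least 5/6")] -/
theorem mul_card_add_two_mul_le_finsum {A : Set (SquareClass K)} (hA : A.Finite)
    (f : SquareClass K → ℕ) (m₀ : ℕ) (hf : ∀ t ∈ A, f t = m₀ ∨ m₀ + 2 ≤ f t) :
    m₀ * Nat.card A + 2 * (Nat.card A - Nat.card {t : SquareClass K | t ∈ A ∧ f t = m₀}) ≤
      ∑ᶠ t ∈ A, f t := by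
  classical
  set s := hA.toFinset with hs
  have hA_card : Nat.card A = s.card := by
    rw [Nat.card_coe_set_eq, Set.ncard_eq_toFinset_card A hA]
  have hB : {t : SquareClass K | t ∈ A ∧ f t = m₀} = ↑(s.filter fun t ↦ f t = m₀) := by
    ext t
    simp [hs, Set.Finite.mem_toFinset]
  have hB_card : Nat.card {t : SquareClass K | t ∈ A ∧ f t = m₀} = (s.filter fun t ↦ f t = m₀).card := by
    rw [hB, Nat.card_coe_set_eq, Set.ncard_coe_finset]
  have hsum : ∑ᶠ t ∈ A, f t = ∑ t ∈ s, f t := by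
    rw [finsum_mem_eq_finite_toFinset_sum f hA]
  rw [hA_card, hB_card, hsum, ← Finset.sum_filter_add_sum_filter_not s (fun t ↦ f t = m₀) f,
    ← Finset.card_filter_add_card_filter_not (s := s) (fun t ↦ f t = m₀)]
  set k := (s.filter fun t ↦ f t = m₀).card with hk
  set l := (s.filter fun t ↦ ¬ f t = m₀).card with hl
  have h1 : (s.filter fun t ↦ f t = m₀).card * m₀ ≤ ∑ t ∈ s.filter (fun t ↦ f t = m₀), f t := by
    rw [← smul_eq_mul]
    exact Finset.card_nsmul_le_sum _ _ _ fun t ht ↦ (Finset.mem_filter.mp ht).2.ge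
  have h2 : (s.filter fun t ↦ ¬ f t = m₀).card * (m₀ + 2) ≤
      ∑ t ∈ s.filter (fun t ↦ ¬ f t = m₀), f t := by
    rw [← smul_eq_mul]
    refine Finset.card_nsmul_le_sum _ _ _ fun t ht ↦ ?_
    obtain ⟨hts, hne⟩ := Finset.mem_filter.mp ht
    rcases hf t ((Set.Finite.mem_toFinset hA).mp hts) with h | h
    · exact absurd h hne
    · exact h
  have hkl : k + l - k = l := by omega
  rw [hkl]
  calc m₀ * (k + l) + 2 * l = k * m₀ + l * (m₀ + 2) := by ring
    _ ≤ _ := Nat.add_le_add h1 h2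

/-- **The Markov–parity step of BKLOS §9.2, in the kernel.** Let `S ⊆ K^×/(K^×)²` have density
`μ` (along the height `H`), let `f : K^×/(K^×)² → ℕ` take on `S` only the value `m₀` or values
`≥ m₀ + 2` (parity), and let the average of `f` over `s ∈ S` be at most `B`. Then at least
`μ · (1 − (B − m₀)/2)` of all classes `t` lie in `S` and have `f t = m₀`. With `m₀ = 0`, `B = 1`
this is "every twist within `T_0(φ)` has even `3`-Selmer rank [and average `≤ 1`], so at least
`50%` of the twists in `T_0(φ)` have rank `0`"; with `m₀ = 1`, `B = 4/3` it is "the `3`-Selmer rank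
is odd and the average `3`-Selmer rank is `4/3` […] at least `5/6` of such twists must have
`3`-Selmer rank `1`". Proof: at height `< X`, `m₀ n + 2(n − k) ≤ ∑_{S(X)} f = avg · n`
(`mul_card_add_two_mul_le_finsum`), so `k/N ≥ (n/N)(1 − (avg − m₀)/2)`; let `X → ∞` along
"eventually avg `≤ B + ε₁`" and "`n/N → μ`".
[cite: BhargavaKlagsbrunLemkeOliverShnidman2019, §9.2 (chunk p0014 L43–L47)] -/
theorem squareClassProportionGe_of_density_of_averageLe {S : Set (SquareClass K)} {μ : ℝ}
    (hS : HasSquareClassDensity (fun t ↦ t ∈ S) μ) {f : SquareClass K → ℕ} {m₀ : ℕ}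
    (hf : ∀ t ∈ S, f t = m₀ ∨ m₀ + 2 ≤ f t) {B : ℝ}
    (hB : SquareClassAverageLe S (fun t ↦ (f t : ℝ)) B) :
    SquareClassProportionGe (fun t ↦ t ∈ S ∧ f t = m₀) (μ * (1 - (B - m₀) / 2)) := by
  -- notation for the counts at height `< X`
  set N : ℕ → ℝ := fun X ↦ (Nat.card {t : SquareClass K | squareClassHeight t < X} : ℝ) with hN
  set n : ℕ → ℝ := fun X ↦
    (Nat.card {t : SquareClass K | t ∈ S ∧ squareClassHeight t < X} : ℝ) with hn
  set k : ℕ → ℝ := fun X ↦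
    (Nat.card {t : SquareClass K | squareClassHeight t < X ∧ (t ∈ S ∧ f t = m₀)} : ℝ) with hk
  set σ : ℕ → ℝ := fun X ↦
    ∑ᶠ t ∈ {t : SquareClass K | t ∈ S ∧ squareClassHeight t < X}, (f t : ℝ) with hσ
  set β : ℝ := 1 - (B - m₀) / 2 with hβ
  -- (I) the finite Markov–parity inequality at each `X`: `m₀ n + 2 (n - k) ≤ σ`
  have hI : ∀ X : ℕ, (m₀ : ℝ) * n X + 2 * (n X - k X) ≤ σ X := by
    intro X
    have hA : {t : SquareClass K | t ∈ S ∧ squareClassHeight t < X}.Finite :=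
      (finite_setOf_squareClassHeight_lt X).subset fun _ ht ↦ ht.2
    have hkset : {t : SquareClass K | squareClassHeight t < X ∧ (t ∈ S ∧ f t = m₀)} =
        {t : SquareClass K | t ∈ {t : SquareClass K | t ∈ S ∧ squareClassHeight t < X} ∧
          f t = m₀} := by
      ext t; simp only [Set.mem_setOf_eq]; tauto
    have hnat := mul_card_add_two_mul_le_finsum hA f m₀ fun t ht ↦ hf t ht.1
    have hkle : Nat.card {t : SquareClass K | t ∈ {t : SquareClass K | t ∈ S ∧
        squareClassHeight t < X} ∧ f t = m₀} ≤
        Nat.card {t : SquareClass K | t ∈ S ∧ squareClassHeight t < X} :=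
      Nat.card_mono hA fun _ ht ↦ ht.1
    have hcast : ((∑ᶠ t ∈ {t : SquareClass K | t ∈ S ∧ squareClassHeight t < X}, f t : ℕ) : ℝ) =
        σ X := by
      simp only [hσ]
      rw [finsum_mem_eq_finite_toFinset_sum _ hA, finsum_mem_eq_finite_toFinset_sum _ hA]
      push_cast
      rfl
    simp only [hn, hk]
    rw [hkset, ← hcast]
    have := (Nat.cast_le (α := ℝ)).mpr hnat
    push_cast [Nat.cast_sub hkle] at this
    linarith
  -- (II) `σ = avg · n`
  have hII : ∀ X : ℕ, σ X = squareClassAverage S (fun t ↦ (f t : ℝ)) X * n X := by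
    intro X
    simp only [squareClassAverage, hσ, hn]
    by_cases h0 : (Nat.card {t : SquareClass K | t ∈ S ∧ squareClassHeight t < X} : ℝ) = 0
    · -- empty `S(X)`: both sides vanish
      have hA : {t : SquareClass K | t ∈ S ∧ squareClassHeight t < X}.Finite :=
        (finite_setOf_squareClassHeight_lt X).subset fun _ ht ↦ ht.2
      have hempty : {t : SquareClass K | t ∈ S ∧ squareClassHeight t < X} = ∅ := by
        have h0' : Nat.card {t : SquareClass K | t ∈ S ∧ squareClassHeight t < X} = 0 := by
          exact_mod_cast h0
        rw [Nat.card_coe_set_eq, Set.ncard_eq_zero hA] at h0'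
        exact h0'
      rw [hempty]
      simp
    · rw [div_mul_cancel₀ _ h0]
  -- basic bounds
  have hN0 : ∀ X, 0 ≤ N X := fun X ↦ Nat.cast_nonneg _
  have hn0 : ∀ X, 0 ≤ n X := fun X ↦ Nat.cast_nonneg _
  have hk0 : ∀ X, 0 ≤ k X := fun X ↦ Nat.cast_nonneg _
  have hprop_n : ∀ X, squareClassProportion (fun t ↦ t ∈ S) X = n X / N X := by
    intro X
    have hset : {t : SquareClass K | squareClassHeight t < X ∧ t ∈ S} =
        {t : SquareClass K | t ∈ S ∧ squareClassHeight t < X} := by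
      ext t; exact and_comm
    simp only [squareClassProportion, hn, hN]
    rw [hset]
  have hprop_k : ∀ X, squareClassProportion (fun t ↦ t ∈ S ∧ f t = m₀) X = k X / N X := fun X ↦ rfl
  have hkN1 : ∀ X, k X / N X ≤ 1 := fun X ↦ by
    rw [← hprop_k]; exact squareClassProportion_le_one _ X
  have hkN0 : ∀ X, 0 ≤ k X / N X := fun X ↦ div_nonneg (hk0 X) (hN0 X)
  have hμ0 : 0 ≤ μ := hS.nonneg
  -- (III) the per-`X` lower bound given an average bound
  have hIII : ∀ X (ε₁ : ℝ), squareClassAverage S (fun t ↦ (f t : ℝ)) X ≤ B + ε₁ →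
      n X / N X * (β - ε₁ / 2) ≤ k X / N X := by
    intro X ε₁ havg
    have h1 := hI X
    rw [hII X] at h1
    -- `2 k ≥ n (2 + m₀ - avg) ≥ n (2 + m₀ - B - ε₁)`
    have h2 : n X * (2 * β - ε₁) ≤ 2 * k X := by
      have : squareClassAverage S (fun t ↦ (f t : ℝ)) X * n X ≤ (B + ε₁) * n X :=
        mul_le_mul_of_nonneg_right havg (hn0 X)
      simp only [hβ]
      nlinarith
    by_cases hNz : N X = 0
    · simp [hNz]
    · have hNpos : 0 < N X := lt_of_le_of_ne (hN0 X) (Ne.symm hNz)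
      rw [div_mul_eq_mul_div, div_le_div_iff_of_pos_right hNpos]
      linarith
  -- conclusion: every `c < μ β` is eventually below `k/N`
  rw [squareClassProportionGe_iff_liminf]
  change μ * β ≤ liminf (fun X ↦ k X / N X) atTop
  refine le_of_forall_lt_imp_le_of_dense fun c hc ↦ ?_
  have hcob : IsCoboundedUnder (· ≥ ·) atTop (fun X ↦ k X / N X) :=
    Filter.IsBoundedUnder.isCoboundedUnder_ge (isBoundedUnder_of ⟨1, fun X ↦ hkN1 X⟩)
  by_cases hc0 : c < 0
  · exact le_liminf_of_le hcob (Eventually.of_forall fun X ↦ hc0.le.trans (hkN0 X))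
  · push Not at hc0
    -- now `0 ≤ c < μ β`, so `μ > 0` and `β > 0`
    have hμβ : 0 < μ * β := lt_of_le_of_lt hc0 hc
    have hβ0 : 0 < β := by
      by_contra h
      push Not at h
      nlinarith [hμ0, h, hμβ]
    have hμpos : 0 < μ := by
      rcases hμ0.eq_or_lt with h | h
      · rw [← h, zero_mul] at hμβ; exact absurd hμβ (lt_irrefl 0)
      · exact h
    set g : ℝ := μ * β - c with hg
    have hgpos : 0 < g := by simp only [hg]; linarith
    -- `ε₁` for the average, `ε₂` for the density
    set ε₁ : ℝ := 2 * g / (3 * μ) with hε₁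
    set ε₂ : ℝ := g / (3 * β) with hε₂
    have hε₁pos : 0 < ε₁ := by positivity
    have hε₂pos : 0 < ε₂ := by positivity
    have hμε₁ : μ * ε₁ / 2 = g / 3 := by
      simp only [hε₁]; field_simp
    have hβε₂ : ε₂ * β = g / 3 := by
      simp only [hε₂]; field_simp
    have hβε₁ : 0 ≤ β - ε₁ / 2 := by
      -- `ε₁/2 = g/(3μ) ≤ μβ/(3μ) = β/3 ≤ β`
      have hgle : g ≤ μ * β := by simp only [hg]; linarith
      have : ε₁ / 2 ≤ β := by
        simp only [hε₁]
        rw [div_le_iff₀ (show (0 : ℝ) < 2 by norm_num), div_le_iff₀ (by positivity)]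
        nlinarith
      linarith
    have hevA : ∀ᶠ X : ℕ in atTop, squareClassAverage S (fun t ↦ (f t : ℝ)) X ≤ B + ε₁ :=
      hB ε₁ hε₁pos
    have hevD : ∀ᶠ X : ℕ in atTop, μ - ε₂ < n X / N X := by
      have := hS.eventually (eventually_gt_nhds (show μ - ε₂ < μ by linarith))
      filter_upwards [this] with X hX
      rwa [hprop_n X] at hX
    refine le_liminf_of_le hcob ?_
    filter_upwards [hevA, hevD] with X hA hD
    have h3 := hIII X ε₁ hA
    have h4 : (μ - ε₂) * (β - ε₁ / 2) ≤ n X / N X * (β - ε₁ / 2) :=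
      mul_le_mul_of_nonneg_right hD.le hβε₁
    have h5 : c ≤ (μ - ε₂) * (β - ε₁ / 2) := by
      have hexp : (μ - ε₂) * (β - ε₁ / 2) = μ * β - μ * ε₁ / 2 - ε₂ * β + ε₂ * (ε₁ / 2) := by ring
      rw [hexp, hμε₁, hβε₂]
      have : 0 ≤ ε₂ * (ε₁ / 2) := by positivity
      simp only [hg] at this ⊢
      linarith
    linarith

/-- **Even case** (`m₀ = 0`): if `S` has density `μ`, `f` is even on `S` and its average over `S`
is at most `B`, then at least `μ (1 − B/2)` of all classes lie in `S` with `f = 0`.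
[cite: BhargavaKlagsbrunLemkeOliverShnidman2019, §9.2 (chunk p0014 L45–L46, "every twist within T_0(φ) has even 3-Selmer rank, so … at least 50% …")] -/
theorem squareClassProportionGe_zero_of_even_of_averageLe {S : Set (SquareClass K)} {μ : ℝ}
    (hS : HasSquareClassDensity (fun t ↦ t ∈ S) μ) {f : SquareClass K → ℕ}
    (hf : ∀ t ∈ S, Even (f t)) {B : ℝ} (hB : SquareClassAverageLe S (fun t ↦ (f t : ℝ)) B) :
    SquareClassProportionGe (fun t ↦ t ∈ S ∧ f t = 0) (μ * (1 - B / 2)) := by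
  have hf' : ∀ t ∈ S, f t = 0 ∨ 0 + 2 ≤ f t := by
    intro t ht
    obtain ⟨r, hr⟩ := hf t ht
    rcases Nat.eq_zero_or_pos r with h | h
    · left; omega
    · right; omega
  have h := squareClassProportionGe_of_density_of_averageLe hS hf' hB
  simp only [Nat.cast_zero, sub_zero] at h
  exact h

/-- **Odd case** (`m₀ = 1`): if `S` has density `μ`, `f` is odd on `S` and its average over `S` is
at most `B`, then at least `μ (3 − B)/2` of all classes lie in `S` with `f = 1`.
[cite: BhargavaKlagsbrunLemkeOliverShnidman2019, §9.2 (chunk p0014 L46–L47, "the 3-Selmer rank is odd and the average … is 4/3 … at least 5/6 …")] -/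
theorem squareClassProportionGe_one_of_odd_of_averageLe {S : Set (SquareClass K)} {μ : ℝ}
    (hS : HasSquareClassDensity (fun t ↦ t ∈ S) μ) {f : SquareClass K → ℕ}
    (hf : ∀ t ∈ S, Odd (f t)) {B : ℝ} (hB : SquareClassAverageLe S (fun t ↦ (f t : ℝ)) B) :
    SquareClassProportionGe (fun t ↦ t ∈ S ∧ f t = 1) (μ * ((3 - B) / 2)) := by
  have hf' : ∀ t ∈ S, f t = 1 ∨ 1 + 2 ≤ f t := by
    intro t ht
    obtain ⟨r, hr⟩ := hf t ht
    rcases Nat.eq_zero_or_pos r with h | h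
    · left; omega
    · right; omega
  have h := squareClassProportionGe_of_density_of_averageLe hS hf' hB
  have e : (1 : ℝ) - (B - ((1 : ℕ) : ℝ)) / 2 = (3 - B) / 2 := by push_cast; ring
  rw [e] at h
  exact h

/-- **BKLOS's factor `½`** (Thm. 2.5 (a) / §9.2): density `μ`, even values, average `≤ 1` over `S`
⟹ at least `μ/2` of all classes lie in `S` with `f = 0`.
[cite: BhargavaKlagsbrunLemkeOliverShnidman2019, Thm. 2.5 (a) (chunk p0005 L18–L19) with §9.2 (chunk p0014 L45–L46)] -/
theorem squareClassProportionGe_zero_half_of_even_of_averageLe_one {S : Set (SquareClass K)}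
    {μ : ℝ} (hS : HasSquareClassDensity (fun t ↦ t ∈ S) μ) {f : SquareClass K → ℕ}
    (hf : ∀ t ∈ S, Even (f t)) (hB : SquareClassAverageLe S (fun t ↦ (f t : ℝ)) 1) :
    SquareClassProportionGe (fun t ↦ t ∈ S ∧ f t = 0) (μ / 2) := by
  have h := squareClassProportionGe_zero_of_even_of_averageLe hS hf hB
  have e : μ * (1 - (1 : ℝ) / 2) = μ / 2 := by ring
  rw [e] at h
  exact h

/-- **BKLOS's factor `⅚`** (Thm. 2.5 (b) / §9.2): density `μ`, odd values, average `≤ 4/3` over `S`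
⟹ at least `⅚ μ` of all classes lie in `S` with `f = 1`.
[cite: BhargavaKlagsbrunLemkeOliverShnidman2019, Thm. 2.5 (b) (chunk p0005 L20–L22) with §9.2 (chunk p0014 L46–L47)] -/
theorem squareClassProportionGe_one_five_sixths_of_odd_of_averageLe {S : Set (SquareClass K)}
    {μ : ℝ} (hS : HasSquareClassDensity (fun t ↦ t ∈ S) μ) {f : SquareClass K → ℕ}
    (hf : ∀ t ∈ S, Odd (f t)) (hB : SquareClassAverageLe S (fun t ↦ (f t : ℝ)) (4 / 3)) :
    SquareClassProportionGe (fun t ↦ t ∈ S ∧ f t = 1) (5 / 6 * μ) := by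
  have h := squareClassProportionGe_one_of_odd_of_averageLe hS hf hB
  have e : μ * ((3 - (4 : ℝ) / 3) / 2) = 5 / 6 * μ := by ring
  rw [e] at h
  exact h

/-- **Whole family**: if an even `ℕ`-valued class function has average `≤ B` over all of
`K^×/(K^×)²` (ordered by height), then at least `1 − B/2` of the classes have `f = 0`.
[cite: BhargavaKlagsbrunLemkeOliverShnidman2019, §9.2 (chunk p0014 L45–L46)] -/
theorem squareClassProportionGe_zero_of_even_of_averageLe_univ {f : SquareClass K → ℕ}
    (hf : ∀ t, Even (f t)) {B : ℝ} (hB : SquareClassAverageLe Set.univ (fun t ↦ (f t : ℝ)) B) :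
    SquareClassProportionGe (fun t ↦ f t = 0) (1 - B / 2) := by
  have hS : HasSquareClassDensity (fun t : SquareClass K ↦ t ∈ (Set.univ : Set (SquareClass K))) 1 := by
    simpa only [Set.mem_univ] using (hasSquareClassDensity_true (K := K))
  have h := squareClassProportionGe_zero_of_even_of_averageLe hS (fun t _ ↦ hf t) hB
  rw [one_mul] at h
  exact h.mono fun t ht ↦ ht.2

end Markov

/-! ## §3 Read-out in a quadratic twist family -/

section Twist

variable {K : Type u} [Field K] [NumberField K]

omit [NumberField K] in
/-- `twistMordellWeilRank V t = 0` is the twist-class property "rank `E^{(s)}(K) = 0` for every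
representative `s`" (`TwistClassSatisfies`; representative independence `twistMordellWeilRank_mk`).
[cite: BhargavaKlagsbrunLemkeOliverShnidman2019, Thm. 2.7 (chunk p0006 L1–L2, "twists E_s have rank 0")] -/
theorem twistClassSatisfies_rank_zero_of_twistMordellWeilRank_eq_zero (V : WeierstrassCurve K)
    {t : SquareClass K} (h : twistMordellWeilRank V t = 0) :
    TwistClassSatisfies V (fun E : WeierstrassCurve K ↦ E.mordellWeilRank = 0) t := by
  intro s hs
  rw [← twistMordellWeilRank_mk V s, hs, h]

namespace BhargavaKlagsbrunLemkeOliverShnidman2019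

/-- **Theorem 2.7's average bound plus even parity give its proportion by the Markov step alone.**
Granting Thm. 2.7 (`thm27_cm_averageRank_le_one`: average rank `≤ 1` under the CM hypothesis) and
the parity input "every twist `E_t` has even Mordell–Weil rank" (the source, after Thm. 2.7: "In the
setting of Theorem 2.7, Goldfeld's minimalist philosophy would predict that `100%` of twists have
rank `0` since they all have even parity"), at least `50%` of the classes `t` have
rank `E_t(K) = 0` — the kernel form of the minimalist bookkeeping "average `≤ 1`, all even ⟹ half
are `0`". (The source's own proof of the `50%` uses `3`-Selmer parity, §9.2; this read-out is
conditional on the rank-parity input `heven`.)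
[cite: BhargavaKlagsbrunLemkeOliverShnidman2019, Thm. 2.7 and the remark after it (chunk p0006 L1–L4) with §9.2 (chunk p0014 L45–L46)] -/
theorem proportion_rank_zero_half_of_thm27_of_even (h : thm27_cm_averageRank_le_one) {K : Type}
    [Field K] [NumberField K] (V : WeierstrassCurve K) [V.IsElliptic] {K' : Type} [Field K']
    [NumberField K'] (hK' : IsImaginaryQuadratic K') (h3 : ¬ (Ideal.span ({3} : Set (𝓞 K'))).IsPrime)
    (e : ℚ ⊗[ℤ] V.endRing ≃ₐ[ℚ] K')
    (heven : ∀ t : SquareClass K, Even (twistMordellWeilRank V t)) :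
    SquareClassProportionGe
      (TwistClassSatisfies V fun E : WeierstrassCurve K ↦ E.mordellWeilRank = 0) (1 / 2) := by
  have hyp : ∃ (K' : Type) (_ : Field K') (_ : NumberField K'), IsImaginaryQuadratic K' ∧
      ¬ (Ideal.span ({3} : Set (𝓞 K'))).IsPrime ∧ Nonempty (ℚ ⊗[ℤ] V.endRing ≃ₐ[ℚ] K') :=
    ⟨K', inferInstance, inferInstance, hK', h3, ⟨e⟩⟩
  have havg := (h K V hyp).1
  have hhalf := squareClassProportionGe_zero_of_even_of_averageLe_univ heven havg
  have e2 : (1 : ℝ) - 1 / 2 = 1 / 2 := by norm_num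
  rw [e2] at hhalf
  exact hhalf.mono fun t ht ↦ twistClassSatisfies_rank_zero_of_twistMordellWeilRank_eq_zero V ht

end BhargavaKlagsbrunLemkeOliverShnidman2019

end Twist

end Literature.NumberTheory.EllipticCurves
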